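import Summits.ResolutionOfSingularities.ResolutionOfSingularities.Theorems.FrobeniusClosingPatchingRelPerfectDepthWeightTwoBLoop
import Summits.ResolutionOfSingularities.ResolutionOfSingularities.Theorems.FrobeniusClosingPatchingRelPerfectDepthTargetsWeightedDefs
import Literature.AlgebraicGeometry.Resolution.CartierDivisorControlledTransformReduced
import Literature.AlgebraicGeometry.Resolution.RegularLocalRingsQuotient
import Literature.AlgebraicGeometry.Resolution.RegularCentreRsopGenerated
import Literature.AlgebraicGeometry.Resolution.BlowupChartMembership
import Literature.AlgebraicGeometry.Resolution.BlowupDisjointCentreSplitting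
import Literature.AlgebraicGeometry.Resolution.StrictTransformClosedSetPieces
import Literature.AlgebraicGeometry.Resolution.KollarNmPartBlowup
import HarnessLib

/-!
# Crux `PatchingRelPerfect` (stmt-ResolutionOfSingularities-16161), chain W5.2 — T6-E1b residual
# `LegalScopedDivisorReduction₃`, PHASE 1 (hand #2): the PURE WEIGHT-TWO pieces loop

[OURS · L1 W5.2 · `LegalScopedDivisorReduction₃` (res-L1-w52-idea-1 OWNER; plan-1 RULING R3 / STEER 5 (3)), hand #2
«phase-1 transport» (res-type-049), brick 1/2] Fact-free; NOT statements of the manuscript under review.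

THE POINT. Phase 1 of the intended proof of `LegalScopedDivisorReduction₃` runs an EMBEDDED resolution sequence of the reduced
surface `V(H)` in the regular threefold `E` whose centres lie in the SINGULAR LOCUS of the strict transforms (CJS's canonical
sequence truncated at the first regular stage). Such centres are LEGAL for the weight-two marked ideal `(H, 2)`: a point of the
centre is a singular point of the (reduced, Cartier) host, so the host — hence `H_j = host · (exceptional monomial)` — has order
`≥ 2` there, and order `≥ 2` at every point of a regular centre piece `Z` is `H_j ≤ 𝓘(Z)²` (ordinary = symbolic powers). So the
E-side transport of T5-E (res-D-pv-054's `WeightTwoB.StateIn` / `CentreIn` / single-piece step `…PieceStepOut`, res-type-049's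
`WeightTwoB.pieces_loop`) runs with ALL WEIGHTS EQUAL TO TWO, i.e. in res-D-pv-016's one-ideal currency
`DepthTargets.IsPureWeightedSeq 2` — the diagonal of `DepthTargets.IsFlagSeq`. This file is that loop; brick 2
(`…DepthLegalCJS`) is the induction over the CJS-type sequence.

* `two_le_idealOrder_of_not_isRegularLocalRing_quotient` — an effective Cartier divisor on a regular scheme has order `≥ 2` at the
  points where its zero scheme is not regular (Matsumura 14.2);
* `StateIn.le_vanishingIdeal_sq_of_forall_two_le` — host order `≥ 2` along a regular piece ⇒ `𝔟 ≤ 𝓘(Z)²` (the piece is legal);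
* `pure_piece_single` — ONE legal piece: `IsPureWeightedSeq 2` extended by one `cons`, the transport state re-established
  (res-D-pv-054's `stateIn'`), reducedness / support of the carried host, boundary bound;
* `pure_pieces_loop` — ALL pieces of a regular centre each of whose points has host order `≥ 2` (the order clause is carried to
  the remaining pieces, which are disjoint from the blown-up one, by (L-D) `IsBlowup.idealOrder_controlledTransform_eq_of_not_mem`).

AI-written; AI review is weaker than expert review.

## References
* H. Matsumura, *Commutative Ring Theory* (1986), Thm. 14.2. [Matsumura1987]
* E. Bierstone, D. Grigoriev, P. Milman, J. Włodarczyk, arXiv:1206.3090, Def. 3.1.3, Lemma 3.2.1 (1), §4 Step 2b.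
  [BierstoneGrigorievMilmanWlodarczyk2011]
* J. Kollár, *Lectures on Resolution of Singularities* (2007), 3.30.2. [Kollar2007]
* The Stacks Project, Tag 080A. [StacksProject]
-/

-- `Summit.<Summit>.<Sub>.Theorems` with `Sub = Summit` (single-conjunct summit, D-0017)
set_option linter.dupNamespace false

noncomputable section

open CategoryTheory CategoryTheory.Limits AlgebraicGeometry TopologicalSpace IsLocalRing
open Literature.AlgebraicGeometry.Resolution Scheme.IdealSheafData

namespace Summit.ResolutionOfSingularities.ResolutionOfSingularities.Theorems

universe u

namespace WeightTwoB

open DepthTargets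

/-! ## §1 Singular points of a Cartier host have order at least two -/

/-- **An effective Cartier divisor has order `≥ 2` at a point of its support where its zero scheme is NOT regular** (the
ambient local ring being regular): `D_z = (g)` with `g ∈ 𝔪_z`, and `g ∉ 𝔪_z²` would make `𝒪_z ⧸ (g)` regular (Matsumura 14.2).
[cite: Matsumura1987, Thm. 14.2] -/
theorem two_le_idealOrder_of_not_isRegularLocalRing_quotient {W : Scheme.{u}} {D : W.IdealSheafData}
    (hD : IsEffectiveCartier D) {z : W} [IsRegularLocalRing (W.presheaf.stalk z)] (hz : z ∈ D.support)
    (hsing : ¬ IsRegularLocalRing (W.presheaf.stalk z ⧸ stalkIdeal D z)) : (2 : ℕ∞) ≤ idealOrder D z := by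
  obtain ⟨g, -, hg⟩ := hD.exists_stalkIdeal_eq_span z
  have hgm : g ∈ maximalIdeal (W.presheaf.stalk z) :=
    (mem_support_iff_stalkIdeal_le D z).mp hz (hg ▸ Ideal.mem_span_singleton_self g)
  have hg2 : g ∈ maximalIdeal (W.presheaf.stalk z) ^ 2 := by
    by_contra h
    rw [hg] at hsing
    exact hsing (IsRegularLocalRing.quotient_span_singleton hgm h).1
  rw [show (2 : ℕ∞) = ((2 : ℕ) : ℕ∞) from rfl, le_idealOrder_iff, hg, Ideal.span_singleton_le_iff_mem]
  exact hg2

/-! ## §2 Legality of a piece along which the host has order at least two -/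

section Legal

variable {W : Scheme.{u}} [IsLocallyNoetherian W] {𝔟 D : W.IdealSheafData} {ℬ 𝒟 : List (W.IdealSheafData × ℕ)}

/-- `𝔟 ≤ D` for a transport state (`𝔟 = D · monomial`). [folklore] -/
theorem StateIn.le_host (S : StateIn 𝔟 D ℬ 𝒟) : 𝔟 ≤ D := by
  rw [S.fac]
  exact Scheme.IdealSheafData.le_def.mpr fun U => by
    rw [Scheme.IdealSheafData.ideal_mul, Pi.mul_apply]; exact Ideal.mul_le_right

/-- **A piece along which the host has order `≥ 2` is LEGAL: `𝔟 ≤ 𝓘(Z)²`** (`ord_z 𝔟 ≥ ord_z D ≥ 2` on `Z`, and order `≥ 2`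
at every point of the regular centre `V(𝓘(Z)) = Z` of the regular scheme `W` gives the containment in the square).
[cite: BierstoneGrigorievMilmanWlodarczyk2011, Lemma 3.2.1 (1)] -/
theorem StateIn.le_vanishingIdeal_sq_of_forall_two_le (S : StateIn 𝔟 D ℬ 𝒟) {Z : Closeds W} (Γ : CentreIn D ℬ Z)
    (h2 : ∀ z ∈ (Z : Set W), (2 : ℕ∞) ≤ idealOrder D z) : 𝔟 ≤ vanishingIdeal Z ^ 2 := by
  refine le_pow_of_isRegular_subscheme_of_forall_le_idealOrder_of_isRegular S.regW Γ.regZ fun y hy => ?_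
  have hy' : y ∈ (Z : Set W) := by rw [← Scheme.IdealSheafData.coe_support_vanishingIdeal Z]; exact hy
  exact (h2 y hy').trans (Kollar2007.Triple.idealOrder_anti S.le_host y)

/-- The max-weight of such a piece is two. [folklore] -/
theorem StateIn.pieceWeight_eq_two_of_forall_two_le (S : StateIn 𝔟 D ℬ 𝒟) {Z : Closeds W}
    (h2 : ∀ z ∈ (Z : Set W), (2 : ℕ∞) ≤ idealOrder D z) : pieceWeight 𝔟 (Z : Set W) = 2 :=
  (pieceWeight_eq_two_iff 𝔟 _).mpr fun y hy => (h2 y hy).trans (Kollar2007.Triple.idealOrder_anti S.le_host y)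

end Legal

/-! ## §3 One legal piece -/

/-- **The single LEGAL piece, packaged**: blowing up ONE piece `Z` of the current transport state along which the host has order
`≥ 2` extends the pure weight-two sequence by one `IsPureWeightedSeq.cons` step (new ideal `τᶜ(𝔟, 2)`), and yields the new
transport state (res-D-pv-054's `stateIn'`, host order `m = ord_η D`, new lists `stepExp`), the reducedness and the support of
the carried host, and the boundary bound. The witnesses `m, e, e'` are exposed so that the data of further (disjoint) pieces can
be transported (`CentreIn.transport`, `IsBlowup.idealOrder_controlledTransform_eq_of_not_mem`).
[cite: BierstoneGrigorievMilmanWlodarczyk2011, §4 Step 2b, Lemma 3.2.1 (1)] [cite: Kollar2007, 3.30.2] -/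
theorem pure_piece_single
    {E W : Scheme.{u}} [IsIntegral W] [IsNoetherian W] {ρ : W ⟶ E} {𝔟₀ : E.IdealSheafData}
    {𝔟 D : W.IdealSheafData} {ℬ 𝒟 : List (W.IdealSheafData × ℕ)} (S : StateIn 𝔟 D ℬ 𝒟)
    (hseq : IsPureWeightedSeq 2 ρ 𝔟₀ 𝔟)
    {Z : Closeds W} (Γ : CentreIn D ℬ Z) (h2 : ∀ z ∈ (Z : Set W), (2 : ℕ∞) ≤ idealOrder D z)
    {B₀ : Set W} (hℬB : ∀ p ∈ ℬ, (p.1.support : Set W) ⊆ B₀) (hZB : (Z : Set W) ⊆ B₀)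
    {W' : Scheme.{u}} {τ : W' ⟶ W} (hτ : IsBlowup τ (vanishingIdeal Z)) :
    ∃ (_ : IsIntegral W') (_ : IsNoetherian W') (m e e' : ℕ),
      IsPureWeightedSeq 2 (τ ≫ ρ) 𝔟₀ (controlledTransform τ (vanishingIdeal Z) 𝔟 2) ∧
        StateIn (controlledTransform τ (vanishingIdeal Z) 𝔟 2) (controlledTransform τ (vanishingIdeal Z) D m)
          (stepExp ℬ τ (vanishingIdeal Z) e) (stepExp 𝒟 τ (vanishingIdeal Z) e') ∧
        controlledTransform τ (vanishingIdeal Z) D m =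
          vanishingIdeal (controlledTransform τ (vanishingIdeal Z) D m).support ∧
        (((controlledTransform τ (vanishingIdeal Z) D m).support : Set W') =
          closure (τ ⁻¹' ((D.support : Set W) \ (Z : Set W)))) ∧
        (∀ p ∈ stepExp ℬ τ (vanishingIdeal Z) e, (p.1.support : Set W') ⊆ τ ⁻¹' B₀) := by
  obtain ⟨η, hη⟩ := Γ.exists_isGenericPoint
  have P : PieceIn 𝔟 D ℬ 𝒟 Z η := S.pieceIn Γ hη
  obtain ⟨m, hm, hm1⟩ := P.exists_idealOrder_host_eq
  -- the centre is not the zero ideal: `Z ⊆ Supp D`, a proper closed subset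
  have hCne : vanishingIdeal Z ≠ ⊥ := by
    intro h0
    have hZ : (Z : Set W) = Set.univ := by
      rw [← Scheme.IdealSheafData.coe_support_vanishingIdeal Z, h0, Scheme.IdealSheafData.support_bot]; rfl
    have hdense := S.hostCartier.dense_compl_support
    have hempty : ((D.support : Set W)ᶜ) = ∅ := by
      rw [Set.compl_empty_iff, Set.eq_univ_iff_forall]
      intro x
      exact Γ.subZ (by rw [hZ]; trivial)
    have := hdense.nonempty
    rw [hempty] at this
    exact Set.not_nonempty_empty this
  haveI hint' : IsIntegral W' := hτ.isIntegral hCne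
  haveI hnoeth' : IsNoetherian W' := isNoetherian_of_isBlowup hτ
  -- reducedness of the carried host ((L-D))
  have hDrad : D.radical = D := by
    conv_rhs => rw [S.hostRad]
    rw [Scheme.IdealSheafData.vanishingIdeal_support]
  have hrad' : (controlledTransform τ (vanishingIdeal Z) D m).radical = controlledTransform τ (vanishingIdeal Z) D m :=
    hτ.radical_controlledTransform_eq S.regW Γ.regZ P.gen' (P.subZ P.η_mem) hm S.hostCartier hDrad
  have hrad : controlledTransform τ (vanishingIdeal Z) D m =
      vanishingIdeal (controlledTransform τ (vanishingIdeal Z) D m).support := by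
    rw [Scheme.IdealSheafData.vanishingIdeal_support, hrad']
  -- the piece is legal: weight two
  have hw : pieceWeight 𝔟 (Z : Set W) = 2 := S.pieceWeight_eq_two_of_forall_two_le h2
  have hle2 : 𝔟 ≤ vanishingIdeal Z ^ 2 := S.le_vanishingIdeal_sq_of_forall_two_le Γ h2
  set w := weightOf ℬ (divisorsOver ℬ (vanishingIdeal Z) (vanishingIdeal Z).support) with hwdef
  set w𝒟 := weightOf 𝒟 (divisorsOver 𝒟 (vanishingIdeal Z) (vanishingIdeal Z).support) with hw𝒟
  -- the new state (res-D-pv-054), read with weight two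
  have S' := stateIn' S Γ hη hτ hm hrad
  rw [hw] at S'
  refine ⟨hint', hnoeth', m, m + w - 2, w𝒟 + (2 - 2), ?_, S', hrad, support_host' S Γ hη hτ hm, ?_⟩
  · -- the `cons` step
    exact IsPureWeightedSeq.cons τ ρ 𝔟₀ 𝔟 _ (vanishingIdeal Z) hseq Γ.regZ hle2 hτ
      (hτ.comap_eq_pow_mul_controlledTransform_of_le_pow hle2)
  · -- the boundary bound
    intro p hp
    rcases mem_stepExp_iff.mp hp with ⟨q, hq, rfl⟩ | rfl
    · intro x' hx'
      exact hℬB q hq (mem_support_of_mem_support_strictTransformIdeal hx')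
    · intro x' hx'
      rw [Scheme.IdealSheafData.support_comap, Closeds.coe_preimage, Scheme.IdealSheafData.coe_support_vanishingIdeal] at hx'
      exact hZB hx'

/-! ## §4 The pure loop over the pieces of a legal centre -/

/-- The order clause of a DISJOINT piece survives the blow-up: off the blown-up piece the carried host has the orders of the
host (`ord_{x'} τᶜ(D, m) = ord_{τ x'} D`, (L-D)). [cite: StacksProject, Tag 02OS] -/
theorem forall_two_le_transport {W W' : Scheme.{u}} {D : W.IdealSheafData} {Z Z₂ : Closeds W} {τ : W' ⟶ W} {m : ℕ}
    (hτ : IsBlowup τ (vanishingIdeal Z)) (hd : Disjoint (Z : Set W) Z₂)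
    (h2 : ∀ z ∈ (Z₂ : Set W), (2 : ℕ∞) ≤ idealOrder D z) :
    ∀ z' ∈ (Z₂.preimage τ.continuous : Set W'), (2 : ℕ∞) ≤ idealOrder (controlledTransform τ (vanishingIdeal Z) D m) z' := by
  intro z' hz'
  have hz : τ z' ∈ (Z₂ : Set W) := hz'
  have hzC : τ z' ∉ ((vanishingIdeal Z).support : Set W) := by
    rw [Scheme.IdealSheafData.coe_support_vanishingIdeal]
    exact Set.disjoint_right.mp hd hz
  rw [hτ.idealOrder_controlledTransform_eq_of_not_mem m hzC]
  exact h2 _ hz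

/-- The induction behind `pure_pieces_loop`, on the number of pieces. [cite: BierstoneGrigorievMilmanWlodarczyk2011, §4 Step 2b] -/
private theorem pure_pieces_loop_aux {E : Scheme.{u}} {𝔟₀ : E.IdealSheafData} (n : ℕ) :
    ∀ {W : Scheme.{u}} [IsIntegral W] [IsNoetherian W] {ρ : W ⟶ E}
      {𝔟 D : W.IdealSheafData} {ℬ 𝒟 : List (W.IdealSheafData × ℕ)} (_S : StateIn 𝔟 D ℬ 𝒟)
      (_hseq : IsPureWeightedSeq 2 ρ 𝔟₀ 𝔟)
      {C : W.IdealSheafData} (_hC : Scheme.IsRegular C.subscheme)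
      {Zs : List (Closeds W)} (_hlen : Zs.length = n) (_hne : Zs ≠ []) (_hP : IsPiecePartition C Zs)
      (_hΓ : ∀ Z ∈ Zs, CentreIn D ℬ Z) (_h2 : ∀ Z ∈ Zs, ∀ z ∈ (Z : Set W), (2 : ℕ∞) ≤ idealOrder D z)
      {B₀ : Set W} (_hℬB : ∀ p ∈ ℬ, (p.1.support : Set W) ⊆ B₀) (_hCB : (C.support : Set W) ⊆ B₀)
      {W' : Scheme.{u}} {τ : W' ⟶ W} (_hτ : IsBlowup τ C),
      ∃ (_ : IsIntegral W') (_ : IsNoetherian W') (𝔟' D' : W'.IdealSheafData) (ℬ' 𝒟' : List (W'.IdealSheafData × ℕ)),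
        IsPureWeightedSeq 2 (τ ≫ ρ) 𝔟₀ 𝔟' ∧ StateIn 𝔟' D' ℬ' 𝒟' ∧
        ((D'.support : Set W') = closure (τ ⁻¹' ((D.support : Set W) \ C.support))) ∧
        (∀ p ∈ ℬ', (p.1.support : Set W') ⊆ τ ⁻¹' B₀) := by
  induction n with
  | zero =>
    intro W _ _ ρ 𝔟 D ℬ 𝒟 S hseq C hC Zs hlen hne
    exact absurd (List.eq_nil_of_length_eq_zero hlen) hne
  | succ n ih =>
    intro W _ _ ρ 𝔟 D ℬ 𝒟 S hseq C hC Zs hlen hne hP hΓ h2 B₀ hℬB hCB W' τ hτ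
    obtain ⟨Z, Zs', rfl⟩ : ∃ Z Zs', Zs = Z :: Zs' := by
      cases Zs with
      | nil => exact absurd rfl hne
      | cons Z Zs' => exact ⟨Z, Zs', rfl⟩
    have hlen' : Zs'.length = n := by simpa using hlen
    have hZC : (Z : Set W) ⊆ (C.support : Set W) := by
      rw [← hP.2]
      exact Set.subset_iUnion₂ (s := fun (Z' : Closeds W) (_ : Z' ∈ Z :: Zs') => (Z' : Set W)) Z List.mem_cons_self
    have hZB : (Z : Set W) ⊆ B₀ := hZC.trans hCB
    by_cases hnil : Zs' = []
    · -- ONE piece: `C = 𝓘(Z)`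
      subst hnil
      have hCZ : C = vanishingIdeal Z := by
        rw [← prod_pieceIdeals_eq_of_isRegular hC hP]; simp [pieceIdeals]
      subst hCZ
      obtain ⟨hint', hnoeth', m, e, e', hseq', S', -, hsupp, hbd⟩ :=
        pure_piece_single S hseq (hΓ Z List.mem_cons_self) (h2 Z List.mem_cons_self) hℬB hZB hτ
      refine ⟨hint', hnoeth', _, _, _, _, hseq', S', ?_, hbd⟩
      rw [hsupp, Scheme.IdealSheafData.coe_support_vanishingIdeal]
    · -- SEVERAL pieces: peel the first
      obtain ⟨X₁, τ₁, τ₂, hcomp, hτ₁, -, -, -, -, hτ₂, hC₁, hP₁⟩ := hτ.exists_comp_eq_of_isPiecePartition_cons hC hP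
      obtain ⟨hint₁, hnoeth₁, m, e, e', hseq₁, S₁, hrad₁, hsupp₁, hbd₁⟩ :=
        pure_piece_single S hseq (hΓ Z List.mem_cons_self) (h2 Z List.mem_cons_self) hℬB hZB hτ₁
      haveI := hint₁
      haveI := hnoeth₁
      -- the centre data and the order clause of the lifted remaining pieces
      have hΓ₁ : ∀ Z₁ ∈ Zs'.map (fun W₀ : Closeds W => W₀.preimage τ₁.continuous),
          CentreIn (controlledTransform τ₁ (vanishingIdeal Z) D m) (stepExp ℬ τ₁ (vanishingIdeal Z) e) Z₁ := by
        intro Z₁ hZ₁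
        obtain ⟨Z₂, hZ₂, rfl⟩ := List.mem_map.mp hZ₁
        exact CentreIn.transport S (hΓ Z List.mem_cons_self) hτ₁ (hΓ Z₂ (List.mem_cons_of_mem _ hZ₂))
          (hP.disjoint_of_mem_tail hZ₂) e hrad₁
      have h2₁ : ∀ Z₁ ∈ Zs'.map (fun W₀ : Closeds W => W₀.preimage τ₁.continuous),
          ∀ z ∈ (Z₁ : Set X₁), (2 : ℕ∞) ≤ idealOrder (controlledTransform τ₁ (vanishingIdeal Z) D m) z := by
        intro Z₁ hZ₁
        obtain ⟨Z₂, hZ₂, rfl⟩ := List.mem_map.mp hZ₁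
        exact forall_two_le_transport hτ₁ (hP.disjoint_of_mem_tail hZ₂) (h2 Z₂ (List.mem_cons_of_mem _ hZ₂))
      have hne₁ : Zs'.map (fun W₀ : Closeds W => W₀.preimage τ₁.continuous) ≠ [] := by
        simpa using hnil
      have hlen₁ : (Zs'.map (fun W₀ : Closeds W => W₀.preimage τ₁.continuous)).length = n := by simpa using hlen'
      -- the support of the remaining centre lies over `⋃ Zs' ⊆ V(C) ⊆ B₀`
      set T : Set W := ⋃ Z₂ ∈ Zs', (Z₂ : Set W) with hT
      have hC₁supp : (((pieceIdeals (Zs'.map fun W₀ : Closeds W => W₀.preimage τ₁.continuous)).prod).support : Set X₁) =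
          τ₁ ⁻¹' T := by
        rw [← hP₁.2, hT]
        ext x
        simp only [List.mem_map, Set.mem_iUnion, exists_prop, Set.mem_preimage]
        constructor
        · rintro ⟨_, ⟨Z₂, hZ₂, rfl⟩, hx⟩
          exact ⟨Z₂, hZ₂, hx⟩
        · rintro ⟨Z₂, hZ₂, hx⟩
          exact ⟨_, ⟨Z₂, hZ₂, rfl⟩, hx⟩
      have hTC : T ⊆ (C.support : Set W) := by
        rw [← hP.2, hT]
        exact Set.iUnion₂_subset fun Z₂ hZ₂ =>
          Set.subset_iUnion₂ (s := fun (Z' : Closeds W) (_ : Z' ∈ Z :: Zs') => (Z' : Set W)) Z₂ (List.mem_cons_of_mem _ hZ₂)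
      have hZT : (Z : Set W) ∪ T = (C.support : Set W) := by
        rw [← hP.2, hT]
        ext x
        simp only [Set.mem_union, Set.mem_iUnion, List.mem_cons, exists_prop]
        constructor
        · rintro (hx | ⟨Z₂, hZ₂, hx⟩)
          · exact ⟨Z, Or.inl rfl, hx⟩
          · exact ⟨Z₂, Or.inr hZ₂, hx⟩
        · rintro ⟨Z', rfl | hZ', hx⟩
          · exact Or.inl hx
          · exact Or.inr ⟨Z', hZ', hx⟩
      have hCB₁ : (((pieceIdeals (Zs'.map fun W₀ : Closeds W => W₀.preimage τ₁.continuous)).prod).support : Set X₁) ⊆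
          τ₁ ⁻¹' B₀ := by
        rw [hC₁supp]; exact Set.preimage_mono (hTC.trans hCB)
      -- the induction hypothesis on the remaining pieces
      obtain ⟨hint', hnoeth', 𝔟', D', ℬ', 𝒟', hseq', S', hsupp', hbd'⟩ :=
        ih S₁ hseq₁ hC₁ hlen₁ hne₁ hP₁ hΓ₁ h2₁ hbd₁ hCB₁ hτ₂
      refine ⟨hint', hnoeth', 𝔟', D', ℬ', 𝒟', ?_, S', ?_, ?_⟩
      · rw [← hcomp, Category.assoc]; exact hseq'
      · -- supports: two-step strict transform = one-step ((L-G))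
        rw [hsupp', hsupp₁, hC₁supp, hτ₂.closure_preimage_closure_preimage_diff τ₁ hC₁supp (D.support : Set W) (Z : Set W),
          hcomp, hZT]
      · intro p hp x' hx'
        have h1 := hbd' p hp hx'
        rw [← hcomp]
        simp only [Set.mem_preimage, Scheme.Hom.comp_base, TopCat.coe_comp, Function.comp_apply] at h1 ⊢
        exact h1

/-- [OURS · L1 W5.2 · LSDR₃ phase 1] **THE PURE WEIGHT-TWO PIECES LOOP**: from a transport state `StateIn 𝔟 D ℬ 𝒟` at the end
of a pure weight-two sequence `IsPureWeightedSeq 2 ρ 𝔟₀ 𝔟`, a regular centre `C` with a non-empty piece partition `Zs` each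
piece carrying its `CentreIn` data AND HOST ORDER `≥ 2` AT EACH OF ITS POINTS, a boundary bound `B₀`, and ANY blowing up `τ`
along `C`, the sequence extends along `τ` (one LEGAL weight-two `cons` per piece) to a transport state on `W'` whose host support
is the strict transform `cl τ⁻¹(Supp D ∖ V(C))` and whose boundary lies over `B₀`.
[cite: BierstoneGrigorievMilmanWlodarczyk2011, §4 Step 2b, Def. 3.1.3, Lemma 3.2.1 (1)] [cite: StacksProject, Tag 080A] -/
theorem pure_pieces_loop
    {E W : Scheme.{u}} [IsIntegral W] [IsNoetherian W] {ρ : W ⟶ E} {𝔟₀ : E.IdealSheafData}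
    {𝔟 D : W.IdealSheafData} {ℬ 𝒟 : List (W.IdealSheafData × ℕ)} (S : StateIn 𝔟 D ℬ 𝒟)
    (hseq : IsPureWeightedSeq 2 ρ 𝔟₀ 𝔟)
    {C : W.IdealSheafData} (hC : Scheme.IsRegular C.subscheme)
    {Zs : List (Closeds W)} (hne : Zs ≠ []) (hP : IsPiecePartition C Zs) (hΓ : ∀ Z ∈ Zs, CentreIn D ℬ Z)
    (h2 : ∀ Z ∈ Zs, ∀ z ∈ (Z : Set W), (2 : ℕ∞) ≤ idealOrder D z)
    {B₀ : Set W} (hℬB : ∀ p ∈ ℬ, (p.1.support : Set W) ⊆ B₀) (hCB : (C.support : Set W) ⊆ B₀)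
    {W' : Scheme.{u}} {τ : W' ⟶ W} (hτ : IsBlowup τ C) :
    ∃ (_ : IsIntegral W') (_ : IsNoetherian W') (𝔟' D' : W'.IdealSheafData) (ℬ' 𝒟' : List (W'.IdealSheafData × ℕ)),
      IsPureWeightedSeq 2 (τ ≫ ρ) 𝔟₀ 𝔟' ∧ StateIn 𝔟' D' ℬ' 𝒟' ∧
      ((D'.support : Set W') = closure (τ ⁻¹' ((D.support : Set W) \ C.support))) ∧
      (∀ p ∈ ℬ', (p.1.support : Set W') ⊆ τ ⁻¹' B₀) :=
  pure_pieces_loop_aux Zs.length S hseq hC rfl hne hP hΓ h2 hℬB hCB hτ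

end WeightTwoB

end Summit.ResolutionOfSingularities.ResolutionOfSingularities.Theorems

end
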